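import Summits.QuantumFields.YangMills.Theorems.BalabanLadderIROddTorusCutWeightRP
import Summits.QuantumFields.YangMills.Theorems.SoloBlindOddChessboard
import HarnessLib

/-!
# Weighted reflection positivity and the reflection Cauchy–Schwarz inequality on the odd torus, with Chebyshev
# weights on the cut and on the fixed slice

Support file (seat ym-infvol-p3, fleet R136 (i); bears on crux `IR` = stmt-QuantumFields-19354 of route `BalabanLadder`,
registered line «af-pincer-T» clause (iii_T) of `TypShellCond` / line «hamming» clause (ii) — hereditary rarity of bad
cells under the periodic Wilson state on the ODD tori `(ℤ/(2S+1))⁴`; count-neutral helper).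

On the odd torus `(ℤ/Lℤ)^d`, `L = 2S+1 ≥ 3`, with the Osterwalder–Seiler reflection `θ t = 1 - t` (fixed site slice
`t = S+1`, cut between the slices `0 | 1`), let `W = exp(c ∑_{q ∈ B} φ_q)` (`φ_q = N - Re tr ρ U_q`, the tree's
`SoloBlind.expObs ρ c B`) be the Chebyshev weight of a set `B` of plaquettes each of which is either CUT (temporal, base
time `0`, `WilsonOddRP.IsOCrossPlaq`) or SHARED (spatial in the fixed slice, `WilsonOddRP.IsOSharedPlaq`), and let
`0 ≤ c ≤ β`.  For real bounded measurable `F, G` depending only on the links of the closed positive half `P ∪ M`: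

* `wilsonExpectation_mul_timeReflect_mul_expObs_nonneg` — `0 ≤ ⟨F · (F ∘ Θ) · W⟩_{Λ,β}`.  The shared factor is a square
  of an `M`-measurable `Θ`-invariant function and is absorbed into `F`; the cut factor is moved into the measure by the
  COUPLING SHIFT `β ↦ β - c` (`exp(c ∑_{q ∈ B} φ_q) e^{-βS} = const · e^{-(β-c)S} · e^{-c ∑_{q ∉ B} φ_q}`), after which the
  remaining cut plaquettes carry the positive-definite weights `exp(+c Re tr ρ U_q)` of
  `wilsonExpectation_mul_timeReflect_mul_expCut_nonneg`, and the positive/negative/shared parts of `e^{-c ∑_{q ∉ B} φ_q}`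
  factor through `P ∪ M`, its reflection, and `M`.
* `wilsonExpectation_mul_timeReflect_mul_expObs_symm` — `⟨F · (G ∘ Θ) · W⟩ = ⟨G · (F ∘ Θ) · W⟩`.
* `sq_wilsonExpectation_mul_timeReflect_mul_expObs_le` — the reflection Cauchy–Schwarz inequality
  `⟨F · (G ∘ Θ) · W⟩² ≤ ⟨F · (F ∘ Θ) · W⟩ · ⟨G · (G ∘ Θ) · W⟩` (discriminant).

This is the Schwarz step of the chessboard estimate on odd tori in BOTH kinds of directions: transverse to the
plaquette orientation the fixed row is the shared slice, in-plane it is the cut row.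

HONEST FRAMING: finite-torus reflection-positivity bookkeeping; no claim about the mass gap or infinite volume.
References: Osterwalder–Seiler, Ann. Phys. 110 (1978) §2; Seiler LNP 159 Ch. 2; Fröhlich–Israel–Lieb–Simon,
CMP 62 (1978) Thm. 2.1.
-/

noncomputable section

open MeasureTheory Finset Filter Topology
open Literature.MathematicalPhysics.QuantumFieldTheory
open Literature.MathematicalPhysics.QuantumFieldTheory.WilsonRP
open Literature.MathematicalPhysics.QuantumFieldTheory.WilsonOddRP
open Summit.QuantumFields.YangMills.Theorems.SoloBlind

namespace Summit.QuantumFields.YangMills.Theorems.OddTorusChessboard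

variable {d L N : ℕ} [NeZero d] [NeZero L] {G : Type*} [Group G] [TopologicalSpace G]
  [IsTopologicalGroup G] [CompactSpace G] [MeasurableSpace G] [BorelSpace G]
  (ρ : G →* Matrix (Fin N) (Fin N) ℂ)

/-! ### §1. The coupling shift `β ↦ β - c` -/

omit [NeZero d] in
/-- **Coupling shift.**  `⟨X⟩_β ≥ 0` as soon as `⟨X · e^{-cS}⟩_{β-c} ≥ 0`: both are positive multiples of the same
product-Haar integral `∫ X e^{-βS}`. -/
theorem wilsonExpectation_nonneg_of_shift (hρ : Continuous ρ) (β c : ℝ) (X : GaugeConfig d L G → ℝ)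
    (h : 0 ≤ wilsonExpectation ρ (β - c) fun U => X U * Real.exp (-c * wilsonAction ρ U)) :
    0 ≤ wilsonExpectation ρ β X := by
  have hIβ := integral_exp_neg_mul_wilsonAction_pos (d := d) (L := L) (G := G) ρ hρ β
  have hIβc := integral_exp_neg_mul_wilsonAction_pos (d := d) (L := L) (G := G) ρ hρ (β - c)
  rw [wilsonExpectation_eq_integral_div ρ hρ] at h ⊢
  have hnum : 0 ≤ ∫ U, X U * Real.exp (-c * wilsonAction ρ U) * Real.exp (-(β - c) * wilsonAction ρ U)
      ∂(Measure.pi fun _ : Edge d L => haarProbability G) := by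
    have := mul_nonneg h hIβc.le
    rwa [div_mul_cancel₀ _ hIβc.ne'] at this
  have heq : (fun U : GaugeConfig d L G => X U * Real.exp (-c * wilsonAction ρ U) *
      Real.exp (-(β - c) * wilsonAction ρ U)) = fun U => X U * Real.exp (-β * wilsonAction ρ U) := by
    funext U
    rw [mul_assoc, ← Real.exp_add]
    congr 2
    ring
  rw [heq] at hnum
  exact div_nonneg hnum hIβ.le

/-! ### §2. The exponential of the split action on the odd torus -/

section Split

variable [Fact (1 < L)]

omit [MeasurableSpace G] [BorelSpace G] in
/-- `e^{-cS} = e^{-cN#Λ₂} · e^{cA(U)} · e^{cA(ΘU)} · e^{cX(U)} · e^{cS_M(U)}` on the odd torus. -/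
theorem exp_neg_mul_wilsonAction_oddSplit (hL : Odd L) (hρ : Continuous ρ) (c : ℝ) (U : GaugeConfig d L G) :
    Real.exp (-c * wilsonAction ρ U) =
      Real.exp (-c * (N * Fintype.card (Plaquette d L))) * Real.exp (c * oPosAction ρ U) *
        Real.exp (c * oPosAction ρ U.timeReflect) * Real.exp (c * oCrossAction ρ U) *
          Real.exp (c * oSharedAction ρ U) := by
  rw [wilsonAction_oddSplit ρ hL hρ U, ← Real.exp_add, ← Real.exp_add, ← Real.exp_add, ← Real.exp_add]
  congr 1
  ring

omit [NeZero d] [NeZero L] [Fact (1 < L)] [TopologicalSpace G] [IsTopologicalGroup G] [CompactSpace G]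
  [MeasurableSpace G] [BorelSpace G] in
/-- `exp(c ∑_{q ∈ B} φ_q) = e^{cN#B} · e^{-c ∑_{q∈B} Re tr ρ U_q}`. -/
theorem expObs_eq_exp_mul_exp (c : ℝ) (B : Finset (Plaquette d L)) (U : GaugeConfig d L G) :
    expObs ρ c B U = Real.exp (c * (N * B.card)) * Real.exp (-c * ∑ q ∈ B, plaqRe ρ U q) := by
  rw [expObs, ← Real.exp_add]
  congr 1
  simp_rw [plaquetteCost_eq_sub_plaqRe]
  rw [Finset.sum_sub_distrib, Finset.sum_const, nsmul_eq_mul]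
  ring

omit [Fact (1 < L)] [TopologicalSpace G] [IsTopologicalGroup G] [CompactSpace G] [MeasurableSpace G]
  [BorelSpace G] in
/-- The crossing action splits over a subset `B` of the cut plaquettes. -/
theorem oCrossAction_eq_sum_add (B : Finset (Plaquette d L)) (hB : ∀ q ∈ B, IsOCrossPlaq q) (U : GaugeConfig d L G) :
    oCrossAction ρ U = ∑ q ∈ B, plaqRe ρ U q +
      ∑ q ∈ (univ.filter IsOCrossPlaq) \ B, plaqRe ρ U q := by
  unfold oCrossAction
  have hsub : B ⊆ univ.filter IsOCrossPlaq := fun q hq => Finset.mem_filter.2 ⟨Finset.mem_univ _, hB q hq⟩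
  rw [← Finset.sum_sdiff hsub, add_comm]

end Split

/-! ### §3. Weighted reflection positivity -/

section Weighted

variable [Fact (1 < L)]

omit [Fact (1 < L)] [TopologicalSpace G] [IsTopologicalGroup G] [CompactSpace G] [MeasurableSpace G] [BorelSpace G] in
/-- A cut or shared plaquette is fixed by the plaquette reflection `ϑ`. -/
theorem plaqReflect_eq_self_of_cross_or_shared (hL : Odd L) {q : Plaquette d L}
    (hq : IsOCrossPlaq q ∨ IsOSharedPlaq q) : plaqReflect q = q := by
  obtain ⟨x, ⟨⟨i, j⟩, hij⟩⟩ := q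
  rcases hq with ⟨hi, ht⟩ | ⟨hi, ht⟩
  · simp only at hi ht
    subst hi
    refine Prod.ext ?_ rfl
    simp only [plaqReflect, ↓reduceIte]
    funext k
    by_cases hk : k = 0
    · subst hk
      apply ZMod.val_injective
      rw [val_timeReflect_shift_zero, if_pos ht, ht]
    · rw [timeReflect_apply_of_ne _ hk, shift_apply_of_ne _ hk]
  · simp only at hi ht
    refine Prod.ext ?_ rfl
    simp only [plaqReflect, hi, ↓reduceIte]
    exact timeReflect_of_val_eq hL ht

omit [Fact (1 < L)] [MeasurableSpace G] [BorelSpace G] in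
/-- The Chebyshev weight of a set of cut/shared plaquettes is reflection invariant. -/
theorem expObs_timeReflect_of_cross_or_shared (hL : Odd L) (hρ : Continuous ρ) (c : ℝ)
    {B : Finset (Plaquette d L)} (hB : ∀ q ∈ B, IsOCrossPlaq q ∨ IsOSharedPlaq q) (U : GaugeConfig d L G) :
    expObs ρ c B U.timeReflect = expObs ρ c B U := by
  rw [expObs_timeReflect ρ hρ]
  congr 1
  rw [Finset.image_congr (g := id) fun q hq => by
    simpa using plaqReflect_eq_self_of_cross_or_shared hL (hB q (Finset.mem_coe.1 hq)), Finset.image_id]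

omit [Fact (1 < L)] [TopologicalSpace G] [IsTopologicalGroup G] [CompactSpace G] [MeasurableSpace G] [BorelSpace G] in
/-- The Chebyshev weight of a set of SHARED plaquettes depends only on the links of the fixed slice `M ⊆ P ∪ M`. -/
theorem dependsOn_expObs_of_shared (c : ℝ) {B : Finset (Plaquette d L)} (hB : ∀ q ∈ B, IsOSharedPlaq q) :
    DependsOn (expObs (G := G) ρ c B) ((posHalfEdges : Finset (Edge d L)) : Set (Edge d L)) := by
  intro U V hUV
  unfold expObs
  congr 2
  refine Finset.sum_congr rfl fun q hq => ?_
  obtain ⟨h1, h2, h3, h4⟩ := edges_of_isOSharedPlaq (hB q hq)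
  have h : ∀ e, IsOSharedEdge e → U e = V e := fun e he => hUV e (by simp [posHalfEdges, he])
  simp only [SoloBlind.plaquetteCost, plaquetteHolonomy, h _ h1, h _ h2, h _ h3, h _ h4]

omit [TopologicalSpace G] [IsTopologicalGroup G] [CompactSpace G] [MeasurableSpace G] [BorelSpace G] in
/-- The positive part of the action depends only on the links of `P ∪ M`. -/
theorem dependsOn_oPosAction_posHalf (hL : Odd L) :
    DependsOn (oPosAction (d := d) (L := L) (G := G) ρ) ((posHalfEdges : Finset (Edge d L)) : Set (Edge d L)) := by
  intro U V hUV
  unfold oPosAction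
  refine Finset.sum_congr rfl fun p hp => ?_
  rw [Finset.mem_filter] at hp
  obtain ⟨h1, h2, h3, h4⟩ := edges_of_isOPosPlaq hL hp.2
  have h : ∀ e, IsOPosEdge e ∨ IsOSharedEdge e → U e = V e := fun e he => hUV e (by
    rcases he with he | he <;> simp [posHalfEdges, he])
  simp only [plaqRe, plaquetteHolonomy, h _ h1, h _ h2, h _ h3, h _ h4]

omit [Fact (1 < L)] [TopologicalSpace G] [IsTopologicalGroup G] [CompactSpace G] [MeasurableSpace G] [BorelSpace G] in
/-- The shared part of the action depends only on the links of `P ∪ M`. -/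
theorem dependsOn_oSharedAction_posHalf :
    DependsOn (oSharedAction (d := d) (L := L) (G := G) ρ) ((posHalfEdges : Finset (Edge d L)) : Set (Edge d L)) :=
  fun U V hUV => dependsOn_oSharedAction ρ fun e he => hUV e (by
    have := Finset.mem_coe.1 he; simp [posHalfEdges, mem_oSharedEdges.1 this])

/-- **Weighted reflection positivity on the odd torus.**  `L` odd, `L ≥ 3`, continuous `ρ`, `0 ≤ c ≤ β`; `B` a set of
cut or shared plaquettes; `F` real, measurable, bounded, depending only on the links of `P ∪ M`.  Then
`0 ≤ ⟨F · (F ∘ Θ) · exp(c ∑_{q ∈ B} φ_q)⟩_{Λ,β}`. -/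
theorem wilsonExpectation_mul_timeReflect_mul_expObs_nonneg (hL : Odd L) (hL3 : 3 ≤ L) (hρ : Continuous ρ)
    {β c : ℝ} (hc : 0 ≤ c) (hcβ : c ≤ β) {F : GaugeConfig d L G → ℝ} (hFm : Measurable F) {F₀ : ℝ}
    (hFb : ∀ U, |F U| ≤ F₀) (hFdep : DependsOn F ((posHalfEdges : Finset (Edge d L)) : Set (Edge d L)))
    (B : Finset (Plaquette d L)) (hB : ∀ q ∈ B, IsOCrossPlaq q ∨ IsOSharedPlaq q) :
    0 ≤ wilsonExpectation ρ β fun U : GaugeConfig d L G => F U * F U.timeReflect * expObs ρ c B U := by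
  classical
  -- split `B` into its cut part and its shared part
  set Bc : Finset (Plaquette d L) := B.filter IsOCrossPlaq with hBc
  set Bs : Finset (Plaquette d L) := B.filter fun q => ¬ IsOCrossPlaq q with hBs
  have hBc' : ∀ q ∈ Bc, IsOCrossPlaq q := fun q hq => (Finset.mem_filter.1 hq).2
  have hBs' : ∀ q ∈ Bs, IsOSharedPlaq q := fun q hq => by
    obtain ⟨hqB, hnc⟩ := Finset.mem_filter.1 hq
    exact (hB q hqB).resolve_left hnc
  have hsplit : ∀ U : GaugeConfig d L G, expObs ρ c B U = expObs ρ c Bc U * expObs ρ c Bs U := by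
    intro U
    rw [expObs_mul_of_disjoint ρ c (Finset.disjoint_filter_filter_not B B IsOCrossPlaq),
      Finset.filter_union_filter_not_eq]
  -- the shared weight is the square of `V = expObs (c/2) Bs`, absorbed into `F`
  set V : GaugeConfig d L G → ℝ := expObs ρ (c / 2) Bs with hV
  have hVsq : ∀ U, expObs ρ c Bs U = V U * V U := fun U => by
    rw [hV, expObs, expObs, ← Real.exp_add]; congr 1; ring
  have hVΘ : ∀ U : GaugeConfig d L G, V U.timeReflect = V U := fun U =>
    expObs_timeReflect_of_cross_or_shared ρ hL hρ (c / 2) (fun q hq => Or.inr (hBs' q hq)) U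
  obtain ⟨V₀, hVb⟩ := exists_abs_expObs_le (G := G) ρ hρ (c / 2) Bs
  set F' : GaugeConfig d L G → ℝ := fun U => F U * V U with hF'
  have hF'm : Measurable F' := hFm.mul (measurable_expObs ρ hρ _ _)
  have hF'b : ∀ U, |F' U| ≤ F₀ * V₀ := fun U => by
    rw [hF', abs_mul]
    exact mul_le_mul (hFb U) (hVb U) (abs_nonneg _) ((abs_nonneg _).trans (hFb U))
  have hF'dep : DependsOn F' ((posHalfEdges : Finset (Edge d L)) : Set (Edge d L)) := fun U W hUW => by
    simp only [hF', hV]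
    rw [hFdep hUW, dependsOn_expObs_of_shared ρ (c / 2) hBs' hUW]
  -- the cut weight goes into the measure by the coupling shift `β ↦ β - c`
  have hrew : (fun U : GaugeConfig d L G => F U * F U.timeReflect * expObs ρ c B U) =
      fun U => F' U * F' U.timeReflect * expObs ρ c Bc U := by
    funext U
    rw [hsplit, hVsq, hF']
    simp only
    rw [hVΘ]
    ring
  rw [hrew]
  refine wilsonExpectation_nonneg_of_shift ρ hρ β c _ ?_
  -- at coupling `β - c`: `F'·F'Θ·expObs c Bc · e^{-cS} = const · K · (K ∘ Θ) · exp(c ∑_{cut q ∉ Bc} Re tr ρ U_q)`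
  set E : Finset (Plaquette d L) := (univ.filter IsOCrossPlaq) \ Bc with hE
  have hE' : ∀ q ∈ E, IsOCrossPlaq q := fun q hq =>
    (Finset.mem_filter.1 (Finset.mem_sdiff.1 hq).1).2
  set K : GaugeConfig d L G → ℝ := fun U =>
    F' U * (Real.exp (c * oPosAction ρ U) * Real.exp (c / 2 * oSharedAction ρ U)) with hK
  set κ : ℝ := Real.exp (c * (N * Bc.card)) * Real.exp (-c * (N * Fintype.card (Plaquette d L))) with hκ
  have hκ0 : 0 ≤ κ := mul_nonneg (Real.exp_pos _).le (Real.exp_pos _).le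
  have hpt : ∀ U : GaugeConfig d L G,
      F' U * F' U.timeReflect * expObs ρ c Bc U * Real.exp (-c * wilsonAction ρ U) =
        κ * (K U * K U.timeReflect * Real.exp (c * ∑ q ∈ E, plaqRe ρ U q)) := by
    intro U
    rw [expObs_eq_exp_mul_exp, exp_neg_mul_wilsonAction_oddSplit ρ hL hρ c U,
      oCrossAction_eq_sum_add ρ Bc hBc' U, hK, hκ]
    simp only
    rw [oSharedAction_timeReflect ρ hL U]
    have : Real.exp (c / 2 * oSharedAction ρ U) * Real.exp (c / 2 * oSharedAction ρ U) =
        Real.exp (c * oSharedAction ρ U) := by rw [← Real.exp_add]; congr 1; ring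
    rw [mul_add, Real.exp_add, ← hE, ← this,
      show Real.exp (-c * ∑ q ∈ Bc, plaqRe ρ U q) = (Real.exp (c * ∑ q ∈ Bc, plaqRe ρ U q))⁻¹ by
        rw [neg_mul, Real.exp_neg]]
    field_simp
  rw [show (fun U : GaugeConfig d L G => F' U * F' U.timeReflect * expObs ρ c Bc U *
      Real.exp (-c * wilsonAction ρ U)) =
      fun U => κ * (K U * K U.timeReflect * Real.exp (c * ∑ q ∈ E, plaqRe ρ U q)) from funext hpt]
  unfold wilsonExpectation
  rw [integral_const_mul]
  refine mul_nonneg hκ0 ?_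
  -- `K` is admissible for the cut-weight lemma at coupling `β - c ≥ 0`
  obtain ⟨A₀, hA₀⟩ : ∃ A₀ : ℝ, ∀ U : GaugeConfig d L G,
      |Real.exp (c * oPosAction ρ U) * Real.exp (c / 2 * oSharedAction ρ U)| ≤ A₀ := by
    refine ⟨Real.exp (|c| * (N * Fintype.card (Plaquette d L))) *
      Real.exp (|c / 2| * (N * Fintype.card (Plaquette d L))), fun U => ?_⟩
    rw [abs_mul, Real.abs_exp, Real.abs_exp]
    refine mul_le_mul (Real.exp_le_exp.2 ?_) (Real.exp_le_exp.2 ?_) (Real.exp_pos _).le (Real.exp_pos _).le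
    · calc c * oPosAction ρ U ≤ |c * oPosAction ρ U| := le_abs_self _
        _ = |c| * |oPosAction ρ U| := abs_mul _ _
        _ ≤ |c| * (N * Fintype.card (Plaquette d L)) :=
            mul_le_mul_of_nonneg_left (abs_sum_filter_plaqRe_le ρ hρ _ U) (abs_nonneg _)
    · calc c / 2 * oSharedAction ρ U ≤ |c / 2 * oSharedAction ρ U| := le_abs_self _
        _ = |c / 2| * |oSharedAction ρ U| := abs_mul _ _
        _ ≤ |c / 2| * (N * Fintype.card (Plaquette d L)) :=
            mul_le_mul_of_nonneg_left (abs_sum_filter_plaqRe_le ρ hρ _ U) (abs_nonneg _)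
  have hKm : Measurable K := hF'm.mul
    (((measurable_sum_filter_plaqRe ρ hρ _).const_mul c).exp.mul
      ((measurable_sum_filter_plaqRe ρ hρ _).const_mul (c / 2)).exp)
  have hKb : ∀ U, |K U| ≤ F₀ * V₀ * A₀ := fun U => by
    rw [hK]; simp only; rw [abs_mul]
    exact mul_le_mul (hF'b U) (hA₀ U) (abs_nonneg _)
      ((abs_nonneg _).trans (hF'b U))
  have hKdep : DependsOn K ((posHalfEdges : Finset (Edge d L)) : Set (Edge d L)) := fun U W hUW => by
    simp only [hK]
    rw [hF'dep hUW, dependsOn_oPosAction_posHalf ρ hL hUW, dependsOn_oSharedAction_posHalf ρ hUW]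
  exact wilsonExpectation_mul_timeReflect_mul_expCut_nonneg ρ hL hL3 hρ (by linarith) hc hKm hKb hKdep E hE'

/-! ### §4. Symmetry and the reflection Cauchy–Schwarz inequality with Chebyshev weights -/

omit [NeZero d] [Fact (1 < L)] in
/-- Bounded measurable real observables are integrable for the torus Wilson state. -/
theorem integrable_wilsonMeasure_of_abs_le (hρ : Continuous ρ) (β : ℝ) {X : GaugeConfig d L G → ℝ}
    (hXm : Measurable X) {C : ℝ} (hXb : ∀ U, |X U| ≤ C) : Integrable X (wilsonMeasure ρ β) := by
  haveI := isProbabilityMeasure_wilsonMeasure (d := d) (L := L) (G := G) ρ hρ β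
  exact Integrable.of_bound hXm.aestronglyMeasurable C (ae_of_all _ fun U => by
    rw [Real.norm_eq_abs]; exact hXb U)

omit [Fact (1 < L)] in
/-- **Symmetry of the weighted Osterwalder–Schrader form**: `⟨F · (G ∘ Θ) · W⟩ = ⟨G · (F ∘ Θ) · W⟩` for the
reflection-invariant Chebyshev weight `W` of a set of cut/shared plaquettes. -/
theorem wilsonExpectation_mul_timeReflect_mul_expObs_symm (hL : Odd L) (hρ : Continuous ρ) (β c : ℝ)
    (F G' : GaugeConfig d L G → ℝ) {B : Finset (Plaquette d L)} (hB : ∀ q ∈ B, IsOCrossPlaq q ∨ IsOSharedPlaq q) :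
    (wilsonExpectation ρ β fun U : GaugeConfig d L G => F U * G' U.timeReflect * expObs ρ c B U) =
      wilsonExpectation ρ β fun U : GaugeConfig d L G => G' U * F U.timeReflect * expObs ρ c B U := by
  rw [← wilsonExpectation_comp_timeReflect ρ hρ β
    (fun U : GaugeConfig d L G => G' U * F U.timeReflect * expObs ρ c B U)]
  congr 1
  funext U
  simp only [timeReflect_timeReflect_config, expObs_timeReflect_of_cross_or_shared ρ hL hρ c hB]
  ring

/-- **The reflection Cauchy–Schwarz inequality with Chebyshev weights on the odd torus**: for `L` odd, `L ≥ 3`,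
continuous `ρ`, `0 ≤ c ≤ β`, a set `B` of cut/shared plaquettes and real bounded measurable `F, G` depending only on
the links of `P ∪ M`,
`⟨F · (G ∘ Θ) · W⟩² ≤ ⟨F · (F ∘ Θ) · W⟩ · ⟨G · (G ∘ Θ) · W⟩`, `W = exp(c ∑_{q ∈ B} φ_q)` — the discriminant of
`t ↦ ⟨(F + tG) · ((F + tG) ∘ Θ) · W⟩ ≥ 0`. -/
theorem sq_wilsonExpectation_mul_timeReflect_mul_expObs_le (hL : Odd L) (hL3 : 3 ≤ L) (hρ : Continuous ρ)
    {β c : ℝ} (hc : 0 ≤ c) (hcβ : c ≤ β)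
    {F : GaugeConfig d L G → ℝ} (hFm : Measurable F) {F₀ : ℝ} (hFb : ∀ U, |F U| ≤ F₀)
    (hFdep : DependsOn F ((posHalfEdges : Finset (Edge d L)) : Set (Edge d L)))
    {G' : GaugeConfig d L G → ℝ} (hGm : Measurable G') {G₀ : ℝ} (hGb : ∀ U, |G' U| ≤ G₀)
    (hGdep : DependsOn G' ((posHalfEdges : Finset (Edge d L)) : Set (Edge d L)))
    (B : Finset (Plaquette d L)) (hB : ∀ q ∈ B, IsOCrossPlaq q ∨ IsOSharedPlaq q) :
    (wilsonExpectation ρ β fun U : GaugeConfig d L G => F U * G' U.timeReflect * expObs ρ c B U) ^ 2 ≤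
      (wilsonExpectation ρ β fun U : GaugeConfig d L G => F U * F U.timeReflect * expObs ρ c B U) *
        (wilsonExpectation ρ β fun U : GaugeConfig d L G => G' U * G' U.timeReflect * expObs ρ c B U) := by
  have hΘm : Measurable (GaugeConfig.timeReflect : GaugeConfig d L G → GaugeConfig d L G) :=
    measurable_timeReflect
  have hWm : Measurable (expObs (G := G) ρ c B) := measurable_expObs ρ hρ c B
  obtain ⟨W₀, hWb⟩ := exists_abs_expObs_le (G := G) ρ hρ c B
  have hF0 : 0 ≤ F₀ := (abs_nonneg _).trans (hFb fun _ => 1)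
  have hG0 : 0 ≤ G₀ := (abs_nonneg _).trans (hGb fun _ => 1)
  have hW0 : 0 ≤ W₀ := (abs_nonneg _).trans (hWb fun _ => 1)
  set a := wilsonExpectation ρ β fun U : GaugeConfig d L G => F U * F U.timeReflect * expObs ρ c B U with ha
  set b := wilsonExpectation ρ β fun U : GaugeConfig d L G => F U * G' U.timeReflect * expObs ρ c B U with hb
  set e := wilsonExpectation ρ β fun U : GaugeConfig d L G => G' U * G' U.timeReflect * expObs ρ c B U with he
  have hsymm : (wilsonExpectation ρ β fun U : GaugeConfig d L G => G' U * F U.timeReflect * expObs ρ c B U) = b :=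
    (wilsonExpectation_mul_timeReflect_mul_expObs_symm ρ hL hρ β c F G' hB).symm
  -- integrability of the four products
  have hint : ∀ (X Y : GaugeConfig d L G → ℝ), Measurable X → Measurable Y → ∀ (X₀ Y₀ : ℝ),
      (∀ U, |X U| ≤ X₀) → (∀ U, |Y U| ≤ Y₀) →
      Integrable (fun U : GaugeConfig d L G => X U * Y U.timeReflect * expObs ρ c B U) (wilsonMeasure ρ β) := by
    intro X Y hXm hYm X₀ Y₀ hXb hYb
    refine integrable_wilsonMeasure_of_abs_le ρ hρ β ((hXm.mul (hYm.comp hΘm)).mul hWm)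
      (C := X₀ * Y₀ * W₀) fun U => ?_
    rw [abs_mul, abs_mul]
    have hX0 : 0 ≤ X₀ := (abs_nonneg _).trans (hXb U)
    exact mul_le_mul (mul_le_mul (hXb U) (hYb _) (abs_nonneg _) hX0) (hWb U) (abs_nonneg _)
      (mul_nonneg hX0 ((abs_nonneg _).trans (hYb U)))
  have hquad : ∀ t : ℝ, 0 ≤ e * (t * t) + (2 * b) * t + a := by
    intro t
    have hHm : Measurable fun U => F U + t * G' U := hFm.add (hGm.const_mul t)
    have hHb : ∀ U, |F U + t * G' U| ≤ F₀ + |t| * G₀ := fun U =>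
      (abs_add_le _ _).trans (add_le_add (hFb U) (by rw [abs_mul]; exact mul_le_mul_of_nonneg_left (hGb U) (abs_nonneg t)))
    have hHdep : DependsOn (fun U => F U + t * G' U) ((posHalfEdges : Finset (Edge d L)) : Set (Edge d L)) :=
      fun U V hUV => by simp only; rw [hFdep hUV, hGdep hUV]
    have h := wilsonExpectation_mul_timeReflect_mul_expObs_nonneg ρ hL hL3 hρ hc hcβ hHm hHb hHdep B hB
    have hexp : (wilsonExpectation ρ β fun U : GaugeConfig d L G =>
        (F U + t * G' U) * (F U.timeReflect + t * G' U.timeReflect) * expObs ρ c B U) =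
        a + t * b + t * (wilsonExpectation ρ β fun U : GaugeConfig d L G =>
          G' U * F U.timeReflect * expObs ρ c B U) + t * t * e := by
      have e1 : (fun U : GaugeConfig d L G =>
          (F U + t * G' U) * (F U.timeReflect + t * G' U.timeReflect) * expObs ρ c B U) = fun U =>
          (F U * F U.timeReflect * expObs ρ c B U + t * (F U * G' U.timeReflect * expObs ρ c B U)) +
          (t * (G' U * F U.timeReflect * expObs ρ c B U) + t * t * (G' U * G' U.timeReflect * expObs ρ c B U)) := by
        funext U; ring
      have iFF := hint F F hFm hFm F₀ F₀ hFb hFb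
      have iFG := hint F G' hFm hGm F₀ G₀ hFb hGb
      have iGF := hint G' F hGm hFm G₀ F₀ hGb hFb
      have iGG := hint G' G' hGm hGm G₀ G₀ hGb hGb
      have i3 : Integrable (fun U : GaugeConfig d L G => t * (F U * G' U.timeReflect * expObs ρ c B U))
          (wilsonMeasure ρ β) := iFG.const_mul t
      have i4 : Integrable (fun U : GaugeConfig d L G => t * (G' U * F U.timeReflect * expObs ρ c B U))
          (wilsonMeasure ρ β) := iGF.const_mul t
      have i5 : Integrable (fun U : GaugeConfig d L G => t * t * (G' U * G' U.timeReflect * expObs ρ c B U))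
          (wilsonMeasure ρ β) := iGG.const_mul _
      have i1 : Integrable (fun U : GaugeConfig d L G =>
          F U * F U.timeReflect * expObs ρ c B U + t * (F U * G' U.timeReflect * expObs ρ c B U))
          (wilsonMeasure ρ β) := iFF.add i3
      have i2 : Integrable (fun U : GaugeConfig d L G =>
          t * (G' U * F U.timeReflect * expObs ρ c B U) + t * t * (G' U * G' U.timeReflect * expObs ρ c B U))
          (wilsonMeasure ρ β) := i4.add i5
      unfold wilsonExpectation at *
      rw [e1, integral_add i1 i2, integral_add iFF i3, integral_add i4 i5,
        integral_const_mul, integral_const_mul, integral_const_mul, ha, hb, he]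
      beta_reduce
      ring
    rw [hexp, hsymm] at h
    nlinarith [h]
  have hdisc := discrim_le_zero hquad
  rw [discrim] at hdisc
  nlinarith [hdisc]

end Weighted

end Summit.QuantumFields.YangMills.Theorems.OddTorusChessboard

end
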